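import Summits.SmoothPoincare4.SmoothPoincare4.Theorems.CongruenceShadowsGriffithsHandlebodyExtensionCoverLiftPlanar
import HarnessLib

/-!
# SmoothPoincare4 / CongruenceShadows — `GriffithsHandlebodyExtension` (item stmt-SmoothPoincare4-15190): lifting the boundary diffeomorphism, IV — smoothness of `τ̂` (E2)

Support file (`--supports` stmt-SmoothPoincare4-15190) of the homothety-cover proof of the genus-one
clause (E) of Griffiths' handlebody extension theorem — *every self-diffeomorphism of the Heegaard torus
`∂V` of the round solid torus fixing the base point and acting trivially on `π₁(∂V)` extends to a
self-diffeomorphism of `V`* (hypothesis `hE` of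
`Literature.Topology.FourManifolds.RoundSolidTorusModel.diffeoExtends_of_map_ker_eq_ker_of_forall_diffeoExtends`).
See the module docstring of `…CoverDefs` for the whole line (E1–E6) and the notation
(`τ̂`, `δ_λ`, `ρ`, `χ`, `f`, `Δ^(c)`, `α`, `L`, `M`, `Ψ̂`, `ẽ_c`).

This part (E2, smoothness): `τ̂` is continuous at the origin and smooth off it — locally `τ̂` is read off from `τV`
through the smooth boundary chart `qcov` of the covering map and the local inverse `LamInv` of `y ↦ covMap (y, 0)`.
-/

-- the registered namespace `Summit.SmoothPoincare4.SmoothPoincare4.Theorems` repeats a component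
set_option linter.dupNamespace false

noncomputable section

namespace Summit.SmoothPoincare4.SmoothPoincare4.Theorems

namespace HomothetyCover

open Set Function Metric Filter
open scoped Topology ContDiff

section Lift

open Literature.Topology.FourManifolds Literature.Topology.FourManifolds.RoundSolidTorusModel
open Complex (I)
open scoped Manifold
variable (τV : (𝓡∂ 3).boundary RoundSolidTorus ≃ₘ⟮𝓡 2, 𝓡 2⟯ (𝓡∂ 3).boundary RoundSolidTorus)
variable {τV}
variable (τV)
variable {τV}

section Smooth

open Literature.Topology.Euclidean
variable {lam : ℝ}
variable {τV : (𝓡∂ 3).boundary RoundSolidTorus ≃ₘ⟮𝓡 2, 𝓡 2⟯ (𝓡∂ 3).boundary RoundSolidTorus}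

/-- `zOf : E2 → ℂ` is smooth. -/
theorem contDiff_zOf : ContDiff ℝ ∞ zOf := by
  have h0 : ContDiff ℝ ∞ fun y : E2 => y 0 := (EuclideanSpace.proj (𝕜 := ℝ) (0 : Fin 2)).contDiff
  have h1 : ContDiff ℝ ∞ fun y : E2 => y 1 := (EuclideanSpace.proj (𝕜 := ℝ) (1 : Fin 2)).contDiff
  exact (Complex.ofRealCLM.contDiff.comp h0).add ((Complex.ofRealCLM.contDiff.comp h1).mul contDiff_const)

/-- The log-polar parametrisation `Epol` is smooth. -/
theorem contDiff_Epol : ContDiff ℝ ∞ (Epol lam) := by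
  have hr : ContDiff ℝ ∞ fun x : ℝ × ℝ => Real.exp (x.1 / kap lam) :=
    Real.contDiff_exp.comp (contDiff_fst.div_const _)
  have hv : ContDiff ℝ ∞ fun x : ℝ × ℝ => (!₂[Real.cos x.2, Real.sin x.2] : E2) := by
    rw [contDiff_euclidean]
    intro i
    fin_cases i
    · simp only [Fin.zero_eta]
      show ContDiff ℝ ∞ fun x : ℝ × ℝ => (!₂[Real.cos x.2, Real.sin x.2] : E2) 0
      simp only [Matrix.cons_val_zero]
      exact Real.contDiff_cos.comp contDiff_snd
    · simp only [Fin.mk_one]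
      show ContDiff ℝ ∞ fun x : ℝ × ℝ => (!₂[Real.cos x.2, Real.sin x.2] : E2) 1
      simp only [Matrix.cons_val_one, Matrix.cons_val_zero]
      exact Real.contDiff_sin.comp contDiff_snd
  exact hr.smul hv

/-- The branch condition at `y₀` itself: `zOf y₀ · e^{−i arg (zOf y₀)} = ‖y₀‖ ∈ slitPlane`. -/
theorem slitPlane_zOf {y₀ : E2} (hy₀ : y₀ ≠ 0) :
    zOf y₀ * Complex.exp (-(((Complex.arg (zOf y₀) : ℝ) : ℂ) * I)) ∈ Complex.slitPlane := by
  have key := Complex.norm_mul_exp_arg_mul_I (zOf y₀)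
  have e : zOf y₀ * Complex.exp (-(((Complex.arg (zOf y₀) : ℝ) : ℂ) * I)) = ((‖zOf y₀‖ : ℝ) : ℂ) := by
    calc zOf y₀ * Complex.exp (-(((Complex.arg (zOf y₀) : ℝ) : ℂ) * I))
        = ((‖zOf y₀‖ : ℝ) : ℂ) * Complex.exp ((Complex.arg (zOf y₀) : ℂ) * I) *
            Complex.exp (-(((Complex.arg (zOf y₀) : ℝ) : ℂ) * I)) := by rw [key]
      _ = ((‖zOf y₀‖ : ℝ) : ℂ) := by
        rw [mul_assoc, ← Complex.exp_add, add_neg_cancel, Complex.exp_zero, mul_one]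
  rw [e]
  exact Complex.ofReal_mem_slitPlane.2 (norm_pos_iff.2 (zOf_ne_zero hy₀))

/-- The branch `polarLogAt φ₀` is smooth at the points where `zOf y · e^{−iφ₀}` is off the cut. -/
theorem contDiffAt_polarLogAt {y₀ : E2} (hy₀ : y₀ ≠ 0) {φ₀ : ℝ}
    (hs : zOf y₀ * Complex.exp (-((φ₀ : ℂ) * I)) ∈ Complex.slitPlane) :
    ContDiffAt ℝ ∞ (polarLogAt lam φ₀) y₀ := by
  have h1 : ContDiffAt ℝ ∞ (fun y : E2 => kap lam * Real.log ‖y‖) y₀ :=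
    contDiffAt_const.mul ((contDiffAt_norm ℝ hy₀).log (norm_ne_zero_iff.2 hy₀))
  have hL : ContDiffAt ℝ ∞ (fun y : E2 => zOf y * Complex.exp (-((φ₀ : ℂ) * I))) y₀ :=
    contDiff_zOf.contDiffAt.mul contDiffAt_const
  have harg : ContDiffAt ℝ ∞ (fun y : E2 => Complex.arg (zOf y * Complex.exp (-((φ₀ : ℂ) * I)))) y₀ := by
    have h2 : ContDiffAt ℝ ∞ (fun z : ℂ => (Complex.log z).im) (zOf y₀ * Complex.exp (-((φ₀ : ℂ) * I))) :=
      Complex.imCLM.contDiff.contDiffAt.comp _ ((Complex.contDiffAt_log hs).restrict_scalars ℝ)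
    have h3 := h2.comp y₀ hL
    refine h3.congr_of_eventuallyEq (Filter.Eventually.of_forall fun y => ?_)
    simp [Complex.log_im]
  exact h1.prodMk (contDiffAt_const.add harg)

/-- `τ̂` read through any branch of the logarithm: `τ̂ = Epol ∘ F̃ ∘ polarLogAt φ₀` off `0`. -/
theorem tauHat_eq_branch (hlam : 1 < lam) (hτ : τV basePt = basePt)
    (h : ∀ γ, FundamentalGroup.mapOfEq (⟨τV, τV.continuous⟩ : C(_, _)) hτ γ = γ) (φ₀ : ℝ)
    {y : E2} (hy : y ≠ 0) : tauHat lam hτ y = Epol lam (liftT hτ (polarLogAt lam φ₀ y)) := by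
  rw [← tauHat_Epol hlam hτ h, Epol_polarLogAt hlam φ₀ hy]

/-- **`τ̂` is continuous off the origin.** -/
theorem continuousAt_tauHat (hlam : 1 < lam) (hτ : τV basePt = basePt)
    (h : ∀ γ, FundamentalGroup.mapOfEq (⟨τV, τV.continuous⟩ : C(_, _)) hτ γ = γ)
    {y₀ : E2} (hy₀ : y₀ ≠ 0) : ContinuousAt (tauHat lam hτ) y₀ := by
  set φ₀ := Complex.arg (zOf y₀) with hφ₀
  have hc : ContinuousAt (fun y => Epol lam (liftT hτ (polarLogAt lam φ₀ y))) y₀ :=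
    contDiff_Epol.continuous.continuousAt.comp ((continuous_liftT hτ).continuousAt.comp
      (contDiffAt_polarLogAt hy₀ (slitPlane_zOf hy₀)).continuousAt)
  refine hc.congr ?_
  filter_upwards [eventually_ne_nhds hy₀] with y hy
  exact (tauHat_eq_branch hlam hτ h φ₀ hy).symm

variable (lam) in
/-- The boundary covering `ℝ² ∖ 0 → ∂V` as a map into the boundary manifold. -/
def qcov (y : E2) : (𝓡∂ 3).boundary RoundSolidTorus :=
  boundaryHomeomorphAddCircle.symm (cT (polarLog lam y))

/-- Underlying point of the boundary point `qcov y`: `covMap (y, 0)`. -/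
theorem incl_qcov (hlam : 1 < lam) {y : E2} (hy : y ≠ 0) :
    RegularSublevel.incl isRegularLevel_fn (qcov lam y).1 = covMap lam (y, 0) := by
  rw [qcov, ← covMap_Epol hlam, Epol_polarLog hlam hy]

/-- A non-zero point of the boundary plane lies in the punctured closed upper half-space. -/
theorem mem_Hpunct_plane {y : E2} (hy : y ≠ 0) : ((y, (0 : ℝ)) : E2 × ℝ) ∈ Hpunct :=
  ⟨le_rfl, fun h => hy (congrArg Prod.fst h)⟩

/-- The boundary covering is smooth (off the origin) for the boundary-manifold structure of `∂V`. -/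
theorem contMDiffAt_qcov (hlam : 1 < lam) {y₀ : E2} (hy₀ : y₀ ≠ 0) :
    ContMDiffAt 𝓘(ℝ, E2) (𝓡 2) ∞ (qcov lam) y₀ := by
  have hamb : ContDiffAt ℝ ∞ (covMap lam ∘ fun y : E2 => (y, (0 : ℝ))) y₀ :=
    (contDiffAt_covMap (mem_Hpunct_plane hy₀)).comp y₀ (contDiffAt_id.prodMk contDiffAt_const)
  have h1 : ContMDiffAt 𝓘(ℝ, E2) (𝓡 3) ∞
      (fun y => RegularSublevel.incl isRegularLevel_fn (qcov lam y).1) y₀ := by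
    refine hamb.contMDiffAt.congr_of_eventuallyEq ?_
    filter_upwards [eventually_ne_nhds hy₀] with y hy
    exact incl_qcov hlam hy
  have h2 := HalfSliceAtlas.contMDiffAt_codRestrict (RegularSublevel.halfSliceAtlas isRegularLevel_fn)
    (g := fun y => RegularSublevel.incl isRegularLevel_fn (qcov lam y).1) (fun y => ((qcov lam y).1).2) h1
  have e2 : (Set.codRestrict (fun y => RegularSublevel.incl isRegularLevel_fn (qcov lam y).1)
      (fn ⁻¹' Set.Iic 0) (fun y => ((qcov lam y).1).2)) = fun y => (qcov lam y).1 :=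
    funext fun y => Subtype.ext rfl
  rw [e2] at h2
  have h3 := BoundaryManifold.contMDiffAt_codRestrict (g := fun y => (qcov lam y).1)
    (fun y => (qcov lam y).2) h2
  have e3 : ((𝓡∂ 3).boundary RoundSolidTorus).codRestrict (fun y => (qcov lam y).1)
      (fun y => (qcov lam y).2) = qcov lam := funext fun y => Subtype.ext rfl
  rw [e3] at h3
  exact h3

/-- The ambient track `y ↦ incl (τ (qcov y))` is smooth off the origin. -/
theorem contDiffAt_incl_τV_qcov (hlam : 1 < lam) {y₀ : E2} (hy₀ : y₀ ≠ 0) :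
    ContDiffAt ℝ ∞ (fun y => RegularSublevel.incl isRegularLevel_fn (τV (qcov lam y)).1) y₀ := by
  have h1 := contMDiffAt_qcov hlam hy₀ (lam := lam)
  have h2 : ContMDiffAt 𝓘(ℝ, E2) (𝓡 2) ∞ (fun y => τV (qcov lam y)) y₀ :=
    τV.contMDiff.contMDiffAt.comp y₀ h1
  have h3 : ContMDiffAt (𝓡 2) (𝓡 3) ∞
      (RegularSublevel.incl isRegularLevel_fn ∘ Subtype.val :
        (𝓡∂ 3).boundary RoundSolidTorus → EuclideanSpace ℝ (Fin 3)) (τV (qcov lam y₀)) :=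
    BoundaryManifold.contMDiffAt_comp_val ((RegularSublevel.contMDiff_incl isRegularLevel_fn) _)
  have h4 := h3.comp y₀ h2
  exact contMDiffAt_iff_contDiffAt.1 h4

variable (lam) in
/-- A local inverse of `y ↦ P (y, 0)` adapted to the longitude `φ₁`:
`v ↦ exp (angAt φ₁ v / κ) · (w/‖w‖)`, `w = wOf v`. -/
def LamInv (φ₁ : ℝ) (v : EuclideanSpace ℝ (Fin 3)) : E2 :=
  Real.exp (angAt φ₁ v / kap lam) • (‖wOf v‖⁻¹ • wOf v)

/-- On the boundary plane `rad (y, 0) = ‖y‖`. -/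
theorem rad_plane (y : E2) : rad (y, (0 : ℝ)) = ‖y‖ := by
  simp [rad, Real.sqrt_sq (norm_nonneg _)]

/-- On the boundary plane the meridian coordinate of `covMap (y, 0)` is the direction `y/‖y‖`. -/
theorem wOf_covMap_plane {y : E2} (hy : y ≠ 0) : wOf (covMap lam (y, 0)) = ‖y‖⁻¹ • y := by
  have hp := mem_Hpunct_plane hy
  have hw : (αinv (y, (0 : ℝ))).2 = ‖y‖⁻¹ • y := by
    simp only [αinv, add_zero, rad_plane]
  ext i
  fin_cases i
  · simp only [Fin.zero_eta, wOf_apply_zero]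
    rw [merC_covMap hp, merW_re, hw]
  · simp only [Fin.mk_one, wOf_apply_one]
    rw [merC_covMap hp, merW_im, hw]

/-- On the boundary plane the local angle of `covMap (y, 0)` recovers the longitude parameter `lng (y, 0)` on the chosen branch. -/
theorem angAt_covMap_plane {y : E2} (hy : y ≠ 0) {φ₁ : ℝ} (hsec : |lng lam (y, 0) - φ₁| < Real.pi) :
    angAt φ₁ (covMap lam (y, 0)) = lng lam (y, 0) := by
  have hp := mem_Hpunct_plane hy
  obtain ⟨h1, h2⟩ := abs_lt.1 hsec
  rw [angAt, longC_covMap hp, lngC, ← Complex.exp_add,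
    show (lng lam (y, 0) : ℂ) * I + -((φ₁ : ℂ) * I) = ((lng lam (y, 0) - φ₁ : ℝ) : ℂ) * I by push_cast; ring,
    Complex.arg_exp_mul_I, (toIocMod_eq_self _).2 ⟨by linarith, by linarith⟩]
  ring

/-- **The local inverse property**: `Λ_{φ₁} (P (y, 0)) = y` on the sector `|ℓ(y) − φ₁| < π`. -/
theorem LamInv_covMap (hlam : 1 < lam) {y : E2} (hy : y ≠ 0) {φ₁ : ℝ}
    (hsec : |lng lam (y, 0) - φ₁| < Real.pi) : LamInv lam φ₁ (covMap lam (y, 0)) = y := by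
  have hn : 0 < ‖y‖ := norm_pos_iff.2 hy
  rw [LamInv, angAt_covMap_plane hy hsec, wOf_covMap_plane hy, lng, rad_plane,
    mul_div_cancel_left₀ _ (kap_ne_zero hlam), Real.exp_log hn, norm_smul, norm_inv, norm_norm,
    inv_mul_cancel₀ hn.ne', inv_one, one_smul, smul_smul, mul_inv_cancel₀ hn.ne', one_smul]

/-- The meridian coordinate `wOf` is smooth. -/
theorem contDiffAt_wOf (v : EuclideanSpace ℝ (Fin 3)) : ContDiffAt ℝ ∞ wOf v := by
  rw [contDiffAt_euclidean]
  intro i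
  fin_cases i
  · simp only [wOf_apply_zero, Fin.zero_eta]
    exact Complex.reCLM.contDiff.contDiffAt.comp v contDiff_merC.contDiffAt
  · simp only [wOf_apply_one, Fin.mk_one]
    exact Complex.imCLM.contDiff.contDiffAt.comp v contDiff_merC.contDiffAt

/-- The local angle `angAt φ₀` is smooth where the rotated longitude phase lies in the slit plane. -/
theorem contDiffAt_angAt {v : EuclideanSpace ℝ (Fin 3)} (hv : 0 < v 0 ^ 2 + v 1 ^ 2) {φ₀ : ℝ}
    (hs : longC v * Complex.exp (-((φ₀ : ℂ) * I)) ∈ Complex.slitPlane) :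
    ContDiffAt ℝ ∞ (angAt φ₀) v := by
  have hL : ContDiffAt ℝ ∞ (fun v => longC v * Complex.exp (-((φ₀ : ℂ) * I))) v :=
    (contDiffAt_longC hv).mul contDiffAt_const
  have harg : ContDiffAt ℝ ∞ (fun v => Complex.arg (longC v * Complex.exp (-((φ₀ : ℂ) * I)))) v := by
    have h1 : ContDiffAt ℝ ∞ (fun z : ℂ => (Complex.log z).im) (longC v * Complex.exp (-((φ₀ : ℂ) * I))) :=
      Complex.imCLM.contDiff.contDiffAt.comp _ ((Complex.contDiffAt_log hs).restrict_scalars ℝ)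
    have h2 := h1.comp v hL
    refine h2.congr_of_eventuallyEq (Filter.Eventually.of_forall fun y => ?_)
    simp [Complex.log_im]
  exact contDiffAt_const.add harg

/-- `Λ_{ℓ(y₁)}` is smooth at `P (y₁, 0)`. -/
theorem contDiffAt_LamInv {y₁ : E2} (hy₁ : y₁ ≠ 0) :
    ContDiffAt ℝ ∞ (LamInv lam (lng lam (y₁, 0))) (covMap lam (y₁, 0)) := by
  have hp := mem_Hpunct_plane hy₁
  have hn : 0 < ‖y₁‖ := norm_pos_iff.2 hy₁
  have hv : 0 < (covMap lam (y₁, 0)) 0 ^ 2 + (covMap lam (y₁, 0)) 1 ^ 2 :=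
    lt_of_lt_of_le (by norm_num) (three_le_sq_add_sq_of_G_nonpos (G_covMap_nonpos hp))
  have hslit : longC (covMap lam (y₁, 0)) * Complex.exp (-(((lng lam (y₁, 0) : ℝ) : ℂ) * I)) ∈
      Complex.slitPlane := by
    rw [longC_covMap hp, lngC, ← Complex.exp_add, add_neg_cancel, Complex.exp_zero]
    exact Complex.one_mem_slitPlane
  have hang := contDiffAt_angAt hv hslit
  have hR : ContDiffAt ℝ ∞ (fun v => Real.exp (angAt (lng lam (y₁, 0)) v / kap lam)) (covMap lam (y₁, 0)) :=
    Real.contDiff_exp.contDiffAt.comp _ (hang.div_const _)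
  have hw := contDiffAt_wOf (covMap lam (y₁, 0))
  have hw0 : wOf (covMap lam (y₁, 0)) ≠ 0 := by
    rw [wOf_covMap_plane hy₁]; exact smul_ne_zero (inv_ne_zero hn.ne') hy₁
  have hnrm : ContDiffAt ℝ ∞ (fun v => ‖wOf v‖⁻¹ • wOf v) (covMap lam (y₁, 0)) :=
    ((hw.norm ℝ hw0).inv (norm_ne_zero_iff.2 hw0)).smul hw
  exact hR.smul hnrm

/-- The longitude parameter `y ↦ lng (y, 0)` is smooth off the origin. -/
theorem contDiffAt_lng_plane {y₁ : E2} (hy₁ : y₁ ≠ 0) :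
    ContDiffAt ℝ ∞ (fun y : E2 => lng lam (y, 0)) y₁ := by
  have h1 : ContDiffAt ℝ ∞ (fun y : E2 => ‖y‖) y₁ := contDiffAt_norm ℝ hy₁
  have h2 : ContDiffAt ℝ ∞ (fun y : E2 => kap lam * Real.log ‖y‖) y₁ :=
    contDiffAt_const.mul (h1.log (norm_ne_zero_iff.2 hy₁))
  refine h2.congr_of_eventuallyEq (Filter.Eventually.of_forall fun y => ?_)
  simp [lng, rad_plane]

/-- **`τ̂` is smooth off the origin** (`τ̂ = Λ ∘ (incl ∘ τ ∘ qcov)` near each point). -/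
theorem contDiffAt_tauHat (hlam : 1 < lam) (hτ : τV basePt = basePt)
    (h : ∀ γ, FundamentalGroup.mapOfEq (⟨τV, τV.continuous⟩ : C(_, _)) hτ γ = γ)
    {y₀ : E2} (hy₀ : y₀ ≠ 0) : ContDiffAt ℝ ∞ (tauHat lam hτ) y₀ := by
  have hy₁ : tauHat lam hτ y₀ ≠ 0 := tauHat_ne_zero hτ hy₀
  have hΓ := contDiffAt_incl_τV_qcov hlam hy₀ (τV := τV)
  have hΓ0 : RegularSublevel.incl isRegularLevel_fn (τV (qcov lam y₀)).1 =
      covMap lam (tauHat lam hτ y₀, 0) :=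
    hlift_tauHat hlam hτ h hy₀ (qcov lam y₀) (incl_qcov hlam hy₀)
  have hΛ : ContDiffAt ℝ ∞ (LamInv lam (lng lam (tauHat lam hτ y₀, 0)))
      ((fun y => RegularSublevel.incl isRegularLevel_fn (τV (qcov lam y)).1) y₀) := by
    rw [show (fun y => RegularSublevel.incl isRegularLevel_fn (τV (qcov lam y)).1) y₀ =
      covMap lam (tauHat lam hτ y₀, 0) from hΓ0]
    exact contDiffAt_LamInv hy₁
  have hcomp := hΛ.comp y₀ hΓ
  refine hcomp.congr_of_eventuallyEq ?_
  -- near `y₀`, `τ̂ y` stays in the sector of the branch `ℓ(τ̂ y₀)`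
  have hcont := continuousAt_tauHat hlam hτ h hy₀
  have hc : ContinuousAt (fun y => |lng lam (tauHat lam hτ y, 0) - lng lam (tauHat lam hτ y₀, 0)|) y₀ :=
    continuous_abs.continuousAt.comp
      (((contDiffAt_lng_plane hy₁).continuousAt.comp hcont).sub continuousAt_const)
  have hlt : (fun y => |lng lam (tauHat lam hτ y, 0) - lng lam (tauHat lam hτ y₀, 0)|) y₀ < Real.pi := by
    simp [Real.pi_pos]
  have hN := hc.eventually_lt continuousAt_const hlt
  filter_upwards [eventually_ne_nhds hy₀, hN] with y hy hsec
  rw [Function.comp_apply, hlift_tauHat hlam hτ h hy (qcov lam y) (incl_qcov hlam hy),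
    LamInv_covMap hlam (tauHat_ne_zero hτ hy) hsec]

end Smooth

end Lift

end HomothetyCover

end Summit.SmoothPoincare4.SmoothPoincare4.Theorems

end
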